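import Summits.QuantumFields.GaugeBoot.PlaquetteGradientIdentity
import HarnessLib

/-!
# Gauge-boot: the EQUIPARTITION BOUND on the plaquette from the loop equation —
# `⟨ū_P⟩_{β,L} ≤ 1 − c_N/(4(d−1)β + c_N)` on every torus at every coupling (large-`N` supplement 18, part 4b)

HONEST FRAMING (cell `pub-gaugeboot`, page 1 of every file): certified bounds on lattice
expectations at STATED coupling, gauge group, dimension and torus size; NOT a mass gap, NOT a
continuum limit, NOT a string tension, NOT large `N`; NOT Yang–Mills-summit-bearing (barriers
`FixedCouplingUltralocality`, `PerturbativeInvisibility`).  An ANALYTIC upper bound on the mean plaquette,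
valid for all `L ≥ 2` and all `β_std ≥ 0`; at the cell's couplings it is far weaker than the SDP certificates
(e.g. `SU(2)`, `D = 4`, `β_std = 2.5`: `⟨ū_P⟩ ≤ 10/11`; `SU(3)`, `D = 4`, `β_std = 6`: `⟨ū_P⟩ ≤ 9/10`) and it
certifies no number of CERTIFIED.md.  Its content is the ORDER: the deficit `1 − ⟨ū_P⟩` is at least `c/β` at weak
coupling (equipartition, the correct power), complementing the `O(log β/β)` upper bound of parts 2–3: on every
torus and for every `N ≥ 2`, `c_N/(4(D−1)β_std + c_N) ≤ 1 − plaquetteExpectation N D L β_std ≤ C_{N,D}·log β_std/β_std`.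

## Content

From part 4a (`PlaquetteGradientIdentity`): the real part of the summed loop equation reads
`(N − s/N)·E[Re T] = (β/4)·E[‖M − Mᴴ‖² − (4s/N)(Im T)²] ≤ (β/4)·E‖M − Mᴴ‖² ≤ 4(d−1)β·Σ_{ν,ε} E[N − Re tr ρ(hol P̃_{ν,ε})]`,
and every plaquette word through the edge has the expectation `N·⟨ū_P⟩` (orbit averaging).  Hence:

* ★★★ `wilsonExpectation_meanPlaquette_le_of_sdPair` — for a lattice representation `r` (`N ≥ 1`) and a real
  weight `0 ≤ s < N²` with the pair identity for all `E_ij − (s/N)δ_ij` (abstract), `d ≥ 2`, `L ≥ 2`, `β ≥ 0`: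
  **`⟨ū_P⟩_{β,L} ≤ 1 − c/(4(d−1)β + c)`, `c = N − s/N`**;
* ★★★ `wilsonExpectation_meanPlaquette_suN_le` (`SU(N)`, `N ≥ 2`, `c = N − 1/N`), ★★★ `…_uN_le` (`U(N)`, `c = N`);
* ★★★ `plaquetteExpectation_le_one_sub` — in the cell's vocabulary (`β_std = N·β`):
  **`plaquetteExpectation N D L β_std ≤ 1 − (N² − 1)/(4(D−1)β_std + N² − 1)`** for `N ≥ 2`, `D ≥ 2`, `L ≥ 2`,
  `β_std ≥ 0`; the table rows `plaquetteExpectation_two_three_le` (`T1`: `≤ 1 − 3/(8β_std + 3)`),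
  `…_two_four_le` (`T2`: `≤ 1 − 1/(4β_std + 1)`), `…_three_three_le` (`T3`: `≤ 1 − 1/(β_std + 1)`),
  `…_three_four_le` (`T4`: `≤ 1 − 2/(3β_std + 2)`);
* ★★ `plaquetteWindow_equipartition` — the analytic shape-(A) window
  `PlaquetteWindow N D L₀ β_std (−1) (1 − (N² − 1)/(4(D−1)β_std + N² − 1))` for every `L₀ ≥ 2`.

[folklore] (equipartition / virial bound for the Wilson action via the Schwinger–Dyson equation.)
-/

noncomputable section

open MeasureTheory Filter Topology NormedSpace
open scoped Matrix.Norms.Frobenius Matrix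
open Literature.MathematicalPhysics.QuantumFieldTheory
open Summit.QuantumFields.YangMills.Cruxes.CurvatureAmnesia.WardDefect.SchwingerDyson

namespace Summit.QuantumFields.GaugeBoot

namespace Equipartition

variable {d L N : ℕ} {G : Type} [Group G] {ρ : G →* Matrix (Fin N) (Fin N) ℂ}

/-! ## The bound -/

section Bound

variable [TopologicalSpace G] [IsTopologicalGroup G] [CompactSpace G] [MeasurableSpace G] [BorelSpace G]
  (r : LatticeRep G)

/-- Continuous real observables on the compact configuration space are integrable for Wilson's measure. [folklore] -/
theorem integrable_of_continuous_real [NeZero L] (β : ℝ) {F : GaugeConfig d L G → ℝ} (hF : Continuous F) :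
    Integrable F (wilsonMeasure (d := d) (L := L) r.ρ β) := by
  haveI : SecondCountableTopology G :=
    (r.continuous.isClosedEmbedding r.injective).isEmbedding.secondCountableTopology
  haveI := isProbabilityMeasure_wilsonMeasure (d := d) (L := L) r.ρ r.continuous β
  obtain ⟨C, hC⟩ := isCompact_univ.exists_bound_of_continuousOn hF.continuousOn
  exact Integrable.of_bound hF.measurable.aestronglyMeasurable C (ae_of_all _ fun U => hC U (Set.mem_univ U))

/-- Interchanging a double finite sum with the integral. [folklore] -/
theorem integral_sum_sum [NeZero L] (β : ℝ) {ι κ : Type*} (S : Finset ι) (T : Finset κ)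
    (f : ι → κ → GaugeConfig d L G → ℂ) (hf : ∀ i k, Continuous (f i k)) :
    ∫ U, ∑ i ∈ S, ∑ k ∈ T, f i k U ∂(wilsonMeasure (d := d) (L := L) r.ρ β) =
      ∑ i ∈ S, ∑ k ∈ T, ∫ U, f i k U ∂(wilsonMeasure (d := d) (L := L) r.ρ β) := by
  rw [integral_finsetSum _ fun i _ => integrable_finsetSum _ fun k _ => integrable_of_continuous r β (hf i k)]
  exact Finset.sum_congr rfl fun i _ => integral_finsetSum _ fun k _ => integrable_of_continuous r β (hf i k)

/-- The real part of a Wilson expectation of a continuous complex observable is the expectation of the real part. [folklore] -/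
theorem re_integral_eq [NeZero L] (β : ℝ) {F : GaugeConfig d L G → ℂ} (hF : Continuous F) :
    (∫ U, F U ∂(wilsonMeasure (d := d) (L := L) r.ρ β)).re = ∫ U, (F U).re ∂(wilsonMeasure (d := d) (L := L) r.ρ β) := by
  have h := Complex.reCLM.integral_comp_comm (integrable_of_continuous r β hF)
  simp only [Complex.reCLM_apply] at h
  exact h.symm

/-- **Every plaquette word through the edge has the expectation of the mean plaquette**:
`E[Re tr ρ(hol P̃_{ν,ε})] = N·⟨ū_P⟩_{β,L}` (`ν ≠ μ`; orbit averaging, `OrbitAverages`). [folklore] -/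
theorem integral_re_trace_plaqWord [NeZero L] (β : ℝ) (x : Site d L) {μ ν : Fin d} (hμν : μ ≠ ν) (ε : Bool)
    (hN : r.N ≠ 0) :
    ∫ U, (r.ρ (wordHolonomy U x (plaqWord μ ν ε))).trace.re ∂(wilsonMeasure (d := d) (L := L) r.ρ β) =
      r.N * wilsonExpectation r.ρ β (meanPlaquette (d := d) (L := L) r.ρ) := by
  cases ε with
  | true =>
    simp_rw [re_trace_plaqWord_true hN]
    rw [integral_const_mul, wilsonExpectation_meanPlaquette_eq_plaquetteTrace r.ρ r.continuous β x hμν]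
    rfl
  | false =>
    simp_rw [re_trace_plaqWord_false r.mem_unitary hN]
    rw [integral_const_mul, wilsonExpectation_meanPlaquette_eq_plaquetteTrace r.ρ r.continuous β (x - Pi.single ν 1) hμν]
    rfl

/-- ★★★ **THE EQUIPARTITION BOUND (abstract form).**  Let `G` be compact with lattice representation `r` (`N ≥ 1`),
`0 ≤ s < N²` a real weight such that every direction `E_ij − (s/N)δ_ij` satisfies the pair identity for the
plaquette words through `(x, μ)` (`s = 1` for `SU(N)`, `s = 0` for `U(N)`), `d ≥ 2`, `L ≥ 2` and `β ≥ 0`.  Then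
`⟨ū_P⟩_{β,L} ≤ 1 − c/(4(d−1)β + c)` with `c = N − s/N`. [folklore] -/
theorem wilsonExpectation_meanPlaquette_le_of_sdPair [NeZero L] (hL : (1 : ZMod L) ≠ 0) (hd : 2 ≤ d) {β : ℝ}
    (hβ : 0 ≤ β) (x : Site d L) (μ : Fin d) {s : ℝ} (hs0 : 0 ≤ s) (hsN : s < (r.N : ℝ) ^ 2)
    (hP : ∀ (ν : Fin d) (ε : Bool) (i j : Fin r.N), SDPair r β x μ x (plaqWord μ ν ε) (unitDir (s : ℂ) i j)) :
    wilsonExpectation r.ρ β (meanPlaquette (d := d) (L := L) r.ρ) ≤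
      1 - ((r.N : ℝ) - s / r.N) / (4 * ((d : ℝ) - 1) * β + ((r.N : ℝ) - s / r.N)) := by
  set μW := wilsonMeasure (d := d) (L := L) r.ρ β with hμW
  haveI : IsProbabilityMeasure μW := isProbabilityMeasure_wilsonMeasure (d := d) (L := L) r.ρ r.continuous β
  set u : ℝ := wilsonExpectation r.ρ β (meanPlaquette (d := d) (L := L) r.ρ) with hu
  set c : ℝ := (r.N : ℝ) - s / r.N with hc
  have hN0 : r.N ≠ 0 := by
    rintro h
    rw [h] at hsN
    simp at hsN
    linarith
  have hNpos : (0 : ℝ) < r.N := by exact_mod_cast Nat.pos_of_ne_zero hN0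
  have hcpos : 0 < c := by
    rw [hc, sub_pos, div_lt_iff₀ hNpos, ← sq]
    exact hsN
  have hd1 : (1 : ℝ) ≤ (d : ℝ) - 1 := by
    have : (2 : ℝ) ≤ d := by exact_mod_cast hd
    linarith
  have hcard : ((Finset.univ.erase μ).card : ℝ) = (d : ℝ) - 1 := by
    rw [Finset.card_erase_of_mem (Finset.mem_univ μ), Finset.card_univ, Fintype.card_fin, Nat.cast_sub (Fin.pos μ),
      Nat.cast_one]
  -- the complex weight is the real `c`
  have hcC : ((r.N : ℂ) - (s : ℂ) / r.N) = (c : ℂ) := by rw [hc]; push_cast; ring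
  -- Step 1: the loop equations, summed over the plaquette words through the edge
  have hsum : (c : ℂ) * ∑ ν ∈ Finset.univ.erase μ, ∑ ε : Bool,
        ∫ U, (r.ρ (wordHolonomy U x (plaqWord μ ν ε))).trace ∂μW +
      (β / 2 : ℂ) * ∑ ν ∈ Finset.univ.erase μ, ∑ ε : Bool, ∑ ν' ∈ Finset.univ.erase μ, ∑ ε' : Bool,
        ∫ U, plaqTerm r.ρ (s : ℂ) x μ U (plaqWord μ ν ε) ν' ε' ∂μW = 0 := by
    have h := Finset.sum_eq_zero (s := Finset.univ.erase μ) fun ν hν => Finset.sum_eq_zero (s := (Finset.univ : Finset Bool))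
      fun ε _ => loopEquation_plaqWord (d := d) (L := L) r hL β x (Finset.ne_of_mem_erase hν).symm ε (s : ℂ) (hP ν ε)
    rw [hcC] at h
    simpa only [Finset.sum_add_distrib, ← Finset.mul_sum] using h
  -- Step 2: the real part of the first sum is `2(d−1)·N·u`
  have hI₁ : (∑ ν ∈ Finset.univ.erase μ, ∑ ε : Bool,
      ∫ U, (r.ρ (wordHolonomy U x (plaqWord μ ν ε))).trace ∂μW).re = 2 * ((d : ℝ) - 1) * (r.N * u) := by
    rw [Complex.re_sum]
    simp_rw [Complex.re_sum]
    have h : ∀ ν ∈ Finset.univ.erase μ, ∀ ε : Bool,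
        (∫ U, (r.ρ (wordHolonomy U x (plaqWord μ ν ε))).trace ∂μW).re = r.N * u := by
      intro ν hν ε
      rw [re_integral_eq r β (continuous_trace_wordHolonomy r x _),
        integral_re_trace_plaqWord r β x (Finset.ne_of_mem_erase hν).symm ε hN0]
    rw [Finset.sum_congr rfl fun ν hν => Finset.sum_congr rfl fun ε _ => h ν hν ε]
    simp only [Finset.sum_const, Finset.card_univ, Fintype.card_bool, nsmul_eq_mul, hcard]
    push_cast
    ring
  -- Step 3: the real part of the double plaquette sum is `≥ −8(d−1)·(total cost) = −8(d−1)·2(d−1)·N·(1−u)`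
  -- continuity bookkeeping
  have hcontV : ∀ ν ε, Continuous fun U : GaugeConfig d L G => (r.ρ (wordHolonomy U x (plaqWord μ ν ε))).trace.re :=
    fun ν ε => Complex.continuous_re.comp (continuous_trace_wordHolonomy r x _)
  have hcontCost : ∀ ν ε, Continuous fun U : GaugeConfig d L G =>
      (r.N : ℝ) - (r.ρ (wordHolonomy U x (plaqWord μ ν ε))).trace.re := fun ν ε => continuous_const.sub (hcontV ν ε)
  have hcontC : Continuous fun U : GaugeConfig d L G => ∑ ν ∈ Finset.univ.erase μ, ∑ ε : Bool,
      ((r.N : ℝ) - (r.ρ (wordHolonomy U x (plaqWord μ ν ε))).trace.re) :=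
    continuous_finsetSum _ fun ν _ => continuous_finsetSum _ fun ε _ => hcontCost ν ε
  have hM : Continuous fun U : GaugeConfig d L G => plaqSum r.ρ x μ U := by
    unfold plaqSum
    exact continuous_finsetSum _ fun ν _ => continuous_finsetSum _ fun ε _ => r.continuous.comp (continuous_wordHolonomy x _)
  have hT : Continuous fun U : GaugeConfig d L G => (plaqSum r.ρ x μ U).trace := hM.matrix_trace
  have hcontQ : Continuous fun U : GaugeConfig d L G =>
      ((plaqSum r.ρ x μ U * plaqSum r.ρ x μ U).trace - (plaqSum r.ρ x μ U * star (plaqSum r.ρ x μ U)).trace -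
        ((s : ℂ) / r.N) * ((plaqSum r.ρ x μ U).trace * ((plaqSum r.ρ x μ U).trace - star (plaqSum r.ρ x μ U).trace))) :=
    (((hM.mul hM).matrix_trace).sub ((hM.mul hM.star).matrix_trace)).sub (continuous_const.mul (hT.mul (hT.sub hT.star)))
  have hcontQre : Continuous fun U : GaugeConfig d L G =>
      (((plaqSum r.ρ x μ U * plaqSum r.ρ x μ U).trace - (plaqSum r.ρ x μ U * star (plaqSum r.ρ x μ U)).trace -
        ((s : ℂ) / r.N) * ((plaqSum r.ρ x μ U).trace * ((plaqSum r.ρ x μ U).trace - star (plaqSum r.ρ x μ U).trace))).re) :=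
    Complex.continuous_re.comp hcontQ
  have hI₂ : -(8 * ((d : ℝ) - 1) * (2 * ((d : ℝ) - 1) * (r.N * (1 - u)))) ≤
      (∑ ν ∈ Finset.univ.erase μ, ∑ ε : Bool, ∑ ν' ∈ Finset.univ.erase μ, ∑ ε' : Bool,
        ∫ U, plaqTerm r.ρ (s : ℂ) x μ U (plaqWord μ ν ε) ν' ε' ∂μW).re := by
    -- merge the four sums into one integral of the closed form
    have hmerge : ∑ ν ∈ Finset.univ.erase μ, ∑ ε : Bool, ∑ ν' ∈ Finset.univ.erase μ, ∑ ε' : Bool,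
        ∫ U, plaqTerm r.ρ (s : ℂ) x μ U (plaqWord μ ν ε) ν' ε' ∂μW =
        ∫ U, ((plaqSum r.ρ x μ U * plaqSum r.ρ x μ U).trace - (plaqSum r.ρ x μ U * star (plaqSum r.ρ x μ U)).trace -
          ((s : ℂ) / r.N) * ((plaqSum r.ρ x μ U).trace * ((plaqSum r.ρ x μ U).trace - star (plaqSum r.ρ x μ U).trace))) ∂μW := by
      simp_rw [← sum_sum_plaqTerm_eq r.mem_unitary (s : ℂ) x μ]
      have hc2 : ∀ ν ε, Continuous fun U : GaugeConfig d L G =>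
          ∑ ν' ∈ Finset.univ.erase μ, ∑ ε' : Bool, plaqTerm r.ρ (s : ℂ) x μ U (plaqWord μ ν ε) ν' ε' :=
        fun ν ε => continuous_finsetSum _ fun ν' _ => continuous_finsetSum _ fun ε' _ => continuous_plaqTerm r (s : ℂ) x μ _ ν' ε'
      rw [integral_sum_sum r β _ _ _ hc2]
      exact Finset.sum_congr rfl fun ν _ => Finset.sum_congr rfl fun ε _ =>
        (integral_sum_sum r β _ _ _ fun ν' ε' => continuous_plaqTerm r (s : ℂ) x μ _ ν' ε').symm
    rw [hmerge, re_integral_eq r β hcontQ]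
    -- the cost integral
    have hcost : ∫ U, ∑ ν ∈ Finset.univ.erase μ, ∑ ε : Bool,
        ((r.N : ℝ) - (r.ρ (wordHolonomy U x (plaqWord μ ν ε))).trace.re) ∂μW = 2 * ((d : ℝ) - 1) * (r.N * (1 - u)) := by
      rw [integral_finsetSum _ fun ν _ => integrable_finsetSum _ fun ε _ => integrable_of_continuous_real r β (hcontCost ν ε)]
      have h : ∀ ν ∈ Finset.univ.erase μ, ∫ U, ∑ ε : Bool,
          ((r.N : ℝ) - (r.ρ (wordHolonomy U x (plaqWord μ ν ε))).trace.re) ∂μW = 2 * (r.N * (1 - u)) := by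
        intro ν hν
        rw [integral_finsetSum _ fun ε _ => integrable_of_continuous_real r β (hcontCost ν ε)]
        have h1 : ∀ ε : Bool, ∫ U, ((r.N : ℝ) - (r.ρ (wordHolonomy U x (plaqWord μ ν ε))).trace.re) ∂μW = r.N * (1 - u) := by
          intro ε
          rw [integral_sub (integrable_const _) (integrable_of_continuous_real r β (hcontV ν ε)),
            integral_re_trace_plaqWord r β x (Finset.ne_of_mem_erase hν).symm ε hN0]
          simp
          ring
        rw [Finset.sum_congr rfl fun ε _ => h1 ε, Finset.sum_const, Finset.card_univ, Fintype.card_bool, nsmul_eq_mul]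
        push_cast
        ring
      rw [Finset.sum_congr rfl h, Finset.sum_const, nsmul_eq_mul, hcard]
      ring
    -- pointwise lower bound and integration
    have hpt : ∀ U : GaugeConfig d L G,
        -(8 * ((d : ℝ) - 1)) * ∑ ν ∈ Finset.univ.erase μ, ∑ ε : Bool,
          ((r.N : ℝ) - (r.ρ (wordHolonomy U x (plaqWord μ ν ε))).trace.re) ≤
        ((plaqSum r.ρ x μ U * plaqSum r.ρ x μ U).trace - (plaqSum r.ρ x μ U * star (plaqSum r.ρ x μ U)).trace -
          ((s : ℂ) / r.N) * ((plaqSum r.ρ x μ U).trace * ((plaqSum r.ρ x μ U).trace - star (plaqSum r.ρ x μ U).trace))).re := by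
      intro U
      rw [re_quadratic_eq]
      have h1 := norm_sq_plaqSum_sub_star_le r.mem_unitary x μ U
      have h2 : 0 ≤ 2 * s / r.N * ((plaqSum r.ρ x μ U).trace.im) ^ 2 := by positivity
      linarith
    have hint := integral_mono (μ := μW) ((integrable_of_continuous_real r β hcontC).const_mul (-(8 * ((d : ℝ) - 1))))
      (integrable_of_continuous_real r β hcontQre) hpt
    rw [integral_const_mul, hcost] at hint
    exact le_trans (le_of_eq (by ring)) hint
  -- Step 4: real parts of the summed equation
  have hre := congrArg Complex.re hsum
  rw [Complex.add_re, Complex.re_ofReal_mul, hI₁, show (β / 2 : ℂ) = ((β / 2 : ℝ) : ℂ) by push_cast; ring,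
    Complex.re_ofReal_mul, Complex.zero_re] at hre
  -- `c·2(d−1)N·u ≤ (β/2)·8(d−1)·2(d−1)N(1−u)`
  have hineq : c * u ≤ 4 * ((d : ℝ) - 1) * β * (1 - u) := by
    have h1 : c * (2 * ((d : ℝ) - 1) * (r.N * u)) ≤ β / 2 * (8 * ((d : ℝ) - 1) * (2 * ((d : ℝ) - 1) * (r.N * (1 - u)))) := by
      have := mul_le_mul_of_nonneg_left hI₂ (by positivity : (0 : ℝ) ≤ β / 2)
      linarith
    have hK : (0 : ℝ) < 2 * ((d : ℝ) - 1) * r.N := by positivity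
    have h2 : (2 * ((d : ℝ) - 1) * r.N) * (c * u) ≤ (2 * ((d : ℝ) - 1) * r.N) * (4 * ((d : ℝ) - 1) * β * (1 - u)) := by
      nlinarith
    exact le_of_mul_le_mul_left h2 hK
  have hden : 0 < 4 * ((d : ℝ) - 1) * β + c := by positivity
  rw [le_sub_iff_add_le, ← le_sub_iff_add_le', div_le_iff₀ hden]
  nlinarith

end Bound

/-! ## `SU(N)` and `U(N)`; the cell's `plaquetteExpectation` -/

section Concrete

open Literature.MathematicalPhysics.QuantumLattice

/-- ★★★ **The equipartition bound for `SU(N)`** (`N ≥ 2`, fundamental representation, tree coupling `β ≥ 0`, torus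
`(ℤ/L)^d` with `d, L ≥ 2`): `⟨ū_P⟩_{β,L} ≤ 1 − (N − 1/N)/(4(d−1)β + N − 1/N)`. [folklore] -/
theorem wilsonExpectation_meanPlaquette_suN_le {N : ℕ} [NeZero L] (hN : 2 ≤ N) (hL : (1 : ZMod L) ≠ 0) (hd : 2 ≤ d)
    {β : ℝ} (hβ : 0 ≤ β) :
    wilsonExpectation (fundamentalRep (Fin N)) β
        (meanPlaquette (d := d) (L := L) (G := Matrix.specialUnitaryGroup (Fin N) ℂ) (fundamentalRep (Fin N))) ≤
      1 - ((N : ℝ) - 1 / N) / (4 * ((d : ℝ) - 1) * β + ((N : ℝ) - 1 / N)) := by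
  have hN2 : (1 : ℝ) < ((fundamentalLatticeRep N).N : ℝ) ^ 2 := by
    rw [fundamentalLatticeRep_N]
    have : (2 : ℝ) ≤ N := by exact_mod_cast hN
    nlinarith
  have h := wilsonExpectation_meanPlaquette_le_of_sdPair (d := d) (L := L) (fundamentalLatticeRep N) hL hd hβ
    (fun _ => 0) ⟨0, by omega⟩ (s := 1) zero_le_one hN2
    (fun ν ε i j => by
      rw [Complex.ofReal_one]
      exact sdPair_specialUnitaryGroup N β _ _ _ _ _ (trace_unitDir_one i j))
  simpa using h

/-- ★★★ **The equipartition bound for `U(N)`** (`N ≥ 1`, defining representation, `β ≥ 0`, `d, L ≥ 2`):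
`⟨ū_P⟩_{β,L} ≤ 1 − N/(4(d−1)β + N)` — here the rows are `N`-uniform after division by `N`:
`1 − ⟨ū_P⟩ ≥ 1/(4(d−1)β/N + 1)`. [folklore] -/
theorem wilsonExpectation_meanPlaquette_uN_le {N : ℕ} [NeZero L] (hN : 1 ≤ N) (hL : (1 : ZMod L) ≠ 0) (hd : 2 ≤ d)
    {β : ℝ} (hβ : 0 ≤ β) :
    wilsonExpectation (unitaryFundamentalRep (Fin N) ℂ) β
        (meanPlaquette (d := d) (L := L) (G := Matrix.unitaryGroup (Fin N) ℂ) (unitaryFundamentalRep (Fin N) ℂ)) ≤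
      1 - (N : ℝ) / (4 * ((d : ℝ) - 1) * β + N) := by
  have hN2 : (0 : ℝ) < ((unitaryFundamentalLatticeRep N).N : ℝ) ^ 2 := by
    rw [unitaryFundamentalLatticeRep_N]
    have : (1 : ℝ) ≤ N := by exact_mod_cast hN
    positivity
  have h := wilsonExpectation_meanPlaquette_le_of_sdPair (d := d) (L := L) (unitaryFundamentalLatticeRep N) hL hd hβ
    (fun _ => 0) ⟨0, by omega⟩ (s := 0) le_rfl hN2
    (fun ν ε i j => by
      rw [Complex.ofReal_zero]
      exact sdPair_unitaryGroup N β _ _ _ _ _)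
  simpa using h

/-- `|plaquetteExpectation N D L β| ≤ 1` (the mean plaquette is bounded by `1` pointwise). [folklore] -/
theorem abs_plaquetteExpectation_le_one (N D L : ℕ) [NeZero L] (β : ℝ) : |plaquetteExpectation N D L β| ≤ 1 := by
  unfold plaquetteExpectation
  haveI := isProbabilityMeasure_wilsonMeasure (d := D) (L := L) (G := SU N) (suRep N) (continuous_suRep N) (β / N)
  refine (abs_wilsonExpectation_le (suRep N) (β / N) _).trans ?_
  unfold wilsonExpectation
  calc ∫ U, |meanPlaquette (d := D) (L := L) (G := SU N) (suRep N) U| ∂wilsonMeasure (suRep N) (β / N)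
      ≤ ∫ _U, (1 : ℝ) ∂wilsonMeasure (suRep N) (β / N) :=
        integral_mono_of_nonneg (Filter.Eventually.of_forall fun _ => abs_nonneg _) (integrable_const _)
          (Filter.Eventually.of_forall fun U => abs_meanPlaquette_le_one (suRep N) (continuous_suRep N) U)
    _ = 1 := by simp

/-- ★★★ **The cell's form.**  For `SU(N)`, `N ≥ 2`, `D ≥ 2`, every torus side `L ≥ 2` and every standard Wilson
coupling `β_std ≥ 0`:
`plaquetteExpectation N D L β_std ≤ 1 − (N² − 1)/(4(D−1)β_std + N² − 1)` —
an analytic UPPER bound on the certified object, with the equipartition order `1/β` at weak coupling. [folklore] -/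
theorem plaquetteExpectation_le_one_sub {N D L : ℕ} [NeZero L] (hN : 2 ≤ N) (hL : 2 ≤ L) (hD : 2 ≤ D) {β : ℝ}
    (hβ : 0 ≤ β) :
    plaquetteExpectation N D L β ≤ 1 - ((N : ℝ) ^ 2 - 1) / (4 * ((D : ℝ) - 1) * β + ((N : ℝ) ^ 2 - 1)) := by
  have hN' : (0 : ℝ) < N := by
    have : (2 : ℝ) ≤ N := by exact_mod_cast hN
    linarith
  have h := wilsonExpectation_meanPlaquette_suN_le (d := D) (L := L) hN (zmod_one_ne_zero hL) hD
    (div_nonneg hβ hN'.le : 0 ≤ β / N)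
  unfold plaquetteExpectation
  refine h.trans (le_of_eq ?_)
  have hD' : (0 : ℝ) ≤ (D : ℝ) - 1 := by
    have : (2 : ℝ) ≤ D := by exact_mod_cast hD
    linarith
  have hden : (0 : ℝ) < 4 * ((D : ℝ) - 1) * β + ((N : ℝ) ^ 2 - 1) := by
    have h4 : (4 : ℝ) ≤ (N : ℝ) ^ 2 := by
      have : (2 : ℝ) ≤ N := by exact_mod_cast hN
      nlinarith
    have h0 : (0 : ℝ) ≤ 4 * ((D : ℝ) - 1) * β := mul_nonneg (mul_nonneg (by norm_num) hD') hβ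
    linarith
  have hkey : ((N : ℝ) - 1 / N) / (4 * ((D : ℝ) - 1) * (β / N) + ((N : ℝ) - 1 / N)) =
      ((N : ℝ) ^ 2 - 1) / (4 * ((D : ℝ) - 1) * β + ((N : ℝ) ^ 2 - 1)) := by
    have hden' : 4 * ((D : ℝ) - 1) * (β / N) + ((N : ℝ) - 1 / N) = (4 * ((D : ℝ) - 1) * β + ((N : ℝ) ^ 2 - 1)) / N := by
      field_simp
    rw [hden', div_div_eq_mul_div]
    field_simp
  rw [hkey]

/-- `T1` (`SU(2)`, `D = 3`): `plaquetteExpectation 2 3 L β_std ≤ 1 − 3/(8β_std + 3)` (`L ≥ 2`, `β_std ≥ 0`). [folklore] -/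
theorem plaquetteExpectation_two_three_le {L : ℕ} [NeZero L] (hL : 2 ≤ L) {β : ℝ} (hβ : 0 ≤ β) :
    plaquetteExpectation 2 3 L β ≤ 1 - 3 / (8 * β + 3) := by
  have h := plaquetteExpectation_le_one_sub (N := 2) (D := 3) (L := L) le_rfl hL (by norm_num) hβ
  refine h.trans (le_of_eq ?_)
  norm_num

/-- `T2` (`SU(2)`, `D = 4`): `plaquetteExpectation 2 4 L β_std ≤ 1 − 1/(4β_std + 1)` (`L ≥ 2`, `β_std ≥ 0`). [folklore] -/
theorem plaquetteExpectation_two_four_le {L : ℕ} [NeZero L] (hL : 2 ≤ L) {β : ℝ} (hβ : 0 ≤ β) :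
    plaquetteExpectation 2 4 L β ≤ 1 - 1 / (4 * β + 1) := by
  have h := plaquetteExpectation_le_one_sub (N := 2) (D := 4) (L := L) le_rfl hL (by norm_num) hβ
  refine h.trans (le_of_eq ?_)
  have h1 : (0 : ℝ) < 4 * β + 1 := by positivity
  have h2 : (0 : ℝ) < 12 * β + 3 := by positivity
  norm_num
  field_simp
  ring

/-- `T3` (`SU(3)`, `D = 3`): `plaquetteExpectation 3 3 L β_std ≤ 1 − 1/(β_std + 1)` (`L ≥ 2`, `β_std ≥ 0`). [folklore] -/
theorem plaquetteExpectation_three_three_le {L : ℕ} [NeZero L] (hL : 2 ≤ L) {β : ℝ} (hβ : 0 ≤ β) :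
    plaquetteExpectation 3 3 L β ≤ 1 - 1 / (β + 1) := by
  have h := plaquetteExpectation_le_one_sub (N := 3) (D := 3) (L := L) (by norm_num) hL (by norm_num) hβ
  refine h.trans (le_of_eq ?_)
  have h1 : (0 : ℝ) < β + 1 := by positivity
  have h2 : (0 : ℝ) < 8 * β + 8 := by positivity
  norm_num
  field_simp

/-- `T4` (`SU(3)`, `D = 4`): `plaquetteExpectation 3 4 L β_std ≤ 1 − 2/(3β_std + 2)` (`L ≥ 2`, `β_std ≥ 0`). [folklore] -/
theorem plaquetteExpectation_three_four_le {L : ℕ} [NeZero L] (hL : 2 ≤ L) {β : ℝ} (hβ : 0 ≤ β) :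
    plaquetteExpectation 3 4 L β ≤ 1 - 2 / (3 * β + 2) := by
  have h := plaquetteExpectation_le_one_sub (N := 3) (D := 4) (L := L) (by norm_num) hL (by norm_num) hβ
  refine h.trans (le_of_eq ?_)
  have h1 : (0 : ℝ) < 3 * β + 2 := by positivity
  have h2 : (0 : ℝ) < 12 * β + 8 := by positivity
  norm_num
  field_simp
  ring

/-- ★★ **Analytic shape-(A) windows with the equipartition upper end**: for `SU(N)`, `N ≥ 2`, `D ≥ 2`, `β_std ≥ 0`
and every `L₀ ≥ 2`: `PlaquetteWindow N D L₀ β_std (−1) (1 − (N² − 1)/(4(D−1)β_std + N² − 1))`. [folklore] -/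
theorem plaquetteWindow_equipartition {N D L₀ : ℕ} (hN : 2 ≤ N) (hD : 2 ≤ D) (hL₀ : 2 ≤ L₀) {β : ℝ} (hβ : 0 ≤ β) :
    PlaquetteWindow N D L₀ β (-1) (1 - ((N : ℝ) ^ 2 - 1) / (4 * ((D : ℝ) - 1) * β + ((N : ℝ) ^ 2 - 1))) := by
  intro L _ _ hL
  exact ⟨(abs_le.1 (abs_plaquetteExpectation_le_one N D L β)).1, plaquetteExpectation_le_one_sub hN (hL₀.trans hL) hD hβ⟩

end Concrete

end Equipartition

end Summit.QuantumFields.GaugeBoot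

end
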